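import Summits.Ventures.PercRepro.ProfileUnicyclicLym

/-!
# PercRepro — THE FIRST OPEN INSTANCE OF `HardRowQ''` IS ONE LEVEL OF A SINGLE ALL-LEVELS STATEMENT
(`RowAll`), WHICH IS «THEOREM A MINUS ONE» FOR THE FREE COEXTENSION (p10, gen 12; `proofs/P10-AVFULL.md` §20)

With `P_k := #biIndepSets M k` and `U_k := #uniIndepSets M k` (ProfileBiIndepDensity, ProfileUnicyclicLym) put
`S_k := U_k + U_{n+1-k}` (`uniSymm`, `n = #E`; symmetric about `(n+1)/2`).  On `#E = ρ + q + 1` the closed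
unicyclic form of the top-but-one level (`profileIneqMinusQ_iff_unicyclic`) reads, with `k := q + 1`,

  `(n − k) · (P_{k−1} + S_k) ≤ k · (P_{k+1} + S_{k+1})`                                                (★)

because `P_{k−1} = P_q = 0` (`biIndepSets_eq_empty_of_lt`: a `q`-set has a complement of `ρ + 1` elements),
`n − k = ρ`, `S_k = U_{q+1} + U_{ρ+1}`, `S_{k+1} = U_{q+2} + U_ρ` and `P_{k+1} = P_{q+2} = P_{ρ−1}`
(`card_biIndepSets_symm`).  The statement (★) makes sense for EVERY finite matroid and EVERY `k` with
`2k + 1 ≤ n`; it is the conjecture `RowAll` below (a `Prop`, NOT asserted).  PAPER (P10-AVFULL.md §20):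
`P_{k−1} + S_k + P_k = P_k(M̂)` is the bi-independent profile of the free coextension `M̂ = L(M ⊕ loop)`
(`M̂ ∖ p = L(M)`, `M̂ / p = M`), so (★) is `(n−k)·P_k(M̂) ≤ k·P_{k+1}(M̂) + (n−2k)·P_k(M)` — Theorem A
(Brändén–Huh, the named fact `BiIndepDensityLogConcave`) for `M̂` reads `(n+1−k)·P_k(M̂) ≤ (k+1)·P_{k+1}(M̂)`:
(★) lowers both constants by one and compensates with `(n−2k)·P_k(M)`; when `M` has a loop (★) IS Theorem A
for `M` minus the loop.  DATA (mining/p10/g12/, two implementations): 0 violations of (★) on all 1,532,688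
pairs `(M, k)` with `M` on `≤ 9` elements, on random sparse paving matroids on `10 … 18` elements and on the
ear-families of gen 11; nothing here asserts (★).

* `uniSymm`, `biIndepSets_eq_empty_of_lt`, `uniSymm_succ_q_of_card_eq`, `uniSymm_add_two_q_of_card_eq`;
* `RowAll` (DEF, not asserted);
* **`profileIneqMinusQ_top_but_one_succ_of_rowAll`**: `RowAll α` gives `Π⁻_{q,ρ−1}(M)` on every `M` with
  `#E = ρ + q + 1`, `q + 2 ≤ ρ` — the first open instance of `HardRowQ''` for every `q`.
-/

open scoped Matroid

namespace PercRepro.Cogirth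

open Finset ThmH Skew Shadow Profile

variable {α : Type} [DecidableEq α] {M : Matroid α} [M.Finite]

/-- The symmetrised unicyclic count `S_k = U_k + U_{n+1-k}` (`n = #E`). -/
noncomputable def uniSymm (M : Matroid α) [M.Finite] (k : ℕ) : ℕ :=
  (uniIndepSets M k).card + (uniIndepSets M ((gr M).card + 1 - k)).card

/-- There is no bi-independent `k`-set when `k + ρ(E) < #E`: the complement has more than `ρ(E)` elements. -/
theorem biIndepSets_eq_empty_of_lt {k : ℕ} (hk : k + rk M (gr M) < (gr M).card) :
    biIndepSets M k = ∅ := by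
  apply Finset.eq_empty_of_forall_notMem
  intro X hX
  rw [mem_biIndepSets] at hX
  obtain ⟨hXg, hXc, -, hXd⟩ := hX
  have h1 : rk M (gr M \ X) ≤ rk M (gr M) := by
    have h : M.eRk ((gr M \ X : Finset α) : Set α) ≤ M.eRk ((gr M : Finset α) : Set α) :=
      M.eRk_mono (by exact_mod_cast (sdiff_subset : gr M \ X ⊆ gr M))
    rw [← coe_rk, ← coe_rk] at h
    exact_mod_cast h
  have h2 := card_sdiff_of_subset hXg
  omega

/-- On `#E = ρ + q + 1`: `S_{q+1} = U_{q+1} + U_{ρ+1}`. -/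
theorem uniSymm_succ_q_of_card_eq {q : ℕ} (hn : (gr M).card = rk M (gr M) + q + 1) :
    uniSymm M (q + 1) = (uniIndepSets M (q + 1)).card + (uniIndepSets M (rk M (gr M) + 1)).card := by
  unfold uniSymm
  congr 3
  omega

/-- On `#E = ρ + q + 1`: `S_{q+2} = U_{q+2} + U_ρ`. -/
theorem uniSymm_add_two_q_of_card_eq {q : ℕ} (hn : (gr M).card = rk M (gr M) + q + 1) :
    uniSymm M (q + 2) = (uniIndepSets M (q + 2)).card + (uniIndepSets M (rk M (gr M))).card := by
  unfold uniSymm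
  congr 3
  omega

/-- **THE CONJECTURE `RowAll` (NOT asserted)**: for every finite matroid on `α` and every `k ≥ 1` with
`2k + 1 ≤ #E`, `(n − k) · (P_{k−1} + S_k) ≤ k · (P_{k+1} + S_{k+1})`, i.e. `(n−k)·P_k(M̂) ≤ k·P_{k+1}(M̂) +
(n−2k)·P_k(M)` for the free coextension `M̂` (Theorem A for `M̂` with both constants lowered by one). -/
def RowAll (α : Type) [DecidableEq α] : Prop :=
  ∀ (M : Matroid α) [M.Finite] (k : ℕ), 1 ≤ k → 2 * k + 1 ≤ (gr M).card →
    ((gr M).card - k) * ((biIndepSets M (k - 1)).card + uniSymm M k) ≤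
      k * ((biIndepSets M (k + 1)).card + uniSymm M (k + 1))

/-- **`RowAll` CLOSES THE FIRST OPEN INSTANCE OF `HardRowQ''`**: on every finite matroid with `#E = ρ + q + 1`
and `q + 2 ≤ ρ`, the co-rank-`q` row holds at the top-but-one level `u = ρ − 1`. -/
theorem profileIneqMinusQ_top_but_one_succ_of_rowAll (h : RowAll α) (M : Matroid α) [M.Finite] {q : ℕ}
    (hn : (gr M).card = rk M (gr M) + q + 1) (hq : q + 2 ≤ rk M (gr M)) :
    ProfileIneqMinusQ M q (rk M (gr M) - 1) := by
  rw [profileIneqMinusQ_iff_unicyclic hn hq]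
  have hk := h M (q + 1) (by omega) (by omega)
  have h0 : biIndepSets M (q + 1 - 1) = ∅ := biIndepSets_eq_empty_of_lt (by omega)
  have hsym : (biIndepSets M (q + 1 + 1)).card = (biIndepSets M (rk M (gr M) - 1)).card := by
    have := card_biIndepSets_symm M (k := q + 1 + 1) (by omega)
    rw [this]
    congr 2
    omega
  rw [h0, card_empty, uniSymm_succ_q_of_card_eq hn, show q + 1 + 1 = q + 2 by rfl,
    uniSymm_add_two_q_of_card_eq hn, hsym, show (gr M).card - (q + 1) = rk M (gr M) by omega] at hk
  linarith

end PercRepro.Cogirth
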